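import Literature.Computability.FineGrained.DTWOVDecode
import Literature.Computability.FineGrained.SplitAndListOV
import HarnessLib

/-!
# OV from subquadratic one-dimensional DTW: the word-RAM program

The program behind `ovInTimePolyDim_of_dtw_inTimeO` (K. Bringmann, M. Künnemann, FOCS 2015,
Thm. 1.1 via Thm. 3.3: an `O(N^{2-ε})` algorithm for DTW on one-dimensional curves gives an
`O(n^{2-ε} poly(d))` algorithm for Orthogonal Vectors), written as structured word-RAM code
(`SProg`, logic `SProg.Achieves`) around one emulated run of the hypothetical DTW program
(`SProg.withSubrun`), exactly as the grouping reduction of `CliqueETHReductionProgram.lean`: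

* **the program** (`DTWRed.Prog.pre kD cD`, `post`, `reduction`): relocate the `OV` input
  `n :: d :: A-bits ++ B-bits`; compute the parameters of the curves of `DTWOVGadgets`
  (`setupA`), the emulated word size `ws = kD · size |dtwInput I|` by a halving loop (`sizeLoop`)
  and the emulator's environment (`setupB`); write the emulated `DTW c` input
  `|x| :: encodeIntList (x ++ y)` — the two curves `ovX I`, `ovY I` point by point, each point
  decoded arithmetically from its position (`xBody`/`xLoop`, `yBody`/`yLoop`, computing
  `ovXval`/`ovYval` of `DTWOVDecode`), then the header (`header`); clear the scratch (`clearRegs`);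
  after the emulated run `post` outputs the bit `[dtw + 2 ≤ n σ₃ + n ρ₁']`, i.e.
  `[dtw ≤ thr I]` for `n ≥ 1` and `0` for `n = 0` (`toNat_dtwDist_ov_le_thr_iff`);
* **ghost parameters** (`Params`: the instance and the two constants of the DTW program), the
  register conventions, the word-size requirement `Fits`, the intended memory stage by stage;
* **verification** of the setup phase (`setupA_spec`, `sizeLoop_spec`, `setupB_spec`).
  The two writing loops, the header and the whole build are verified in
  `DTWReductionLoops.lean`; the run, word size and time in `DTWReduction.lean`.

## References

* K. Bringmann, M. Künnemann, FOCS 2015 (arXiv:1502.01063), Thm. 1.1, Thm. 3.3 (proof, §3.1).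
* V. Vassilevska Williams, Proc. ICM 2018, §2 (the word RAM; algorithms calling an algorithm).
-/

namespace Literature.Computability.FineGrained

open Cryptography Cryptography.WordRAM Cryptography.WordRAM.SProg

namespace DTWRed

namespace Prog

/-! ### Operand shorthands -/

/-- Direct operand: register / cell `i`. [folklore] -/
abbrev r (i : ℕ) : Operand := .dir i
/-- Indirect operand through cell `i`. [folklore] -/
abbrev pt (i : ℕ) : Operand := .ind i
/-- Immediate operand. [folklore] -/
abbrev im (c : ℕ) : Operand := .imm c

/-! ### Register map

`0 = X` (base of the relocated input, `x[j]` in cell `X + j`), `1 = X - 1` (set by `relocate`);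
`2 = n`, `3 = d`, `4 = d' = d + 1`, `5 = L = 2d'`, `6 = κ₁`, `7 = ℓx`, `8 = ℓy`, `9 = κ₂`;
the emulator's layout `10 = Bv`, `11 = Sv`, `12 = Gv (= 0)`, `13 = Pw = 2^ws`, temporaries
`14, 15, 16`; `17` post; `18 = ℓx + κ₂`, `19 = ℓy + κ₂`, `20 = M₁`, `21 = M₂`, `22 = |x|`,
`23 = |y|`, `24 = Ny = |x| + |y| + 1`, `25 = thr' = n σ₃ + n ρ₁'`, `26 = L + κ₁`,
`27 = B₀ = X + 2 + n d` (base of the `B`-bits); scratch `30–35` (setup), `40–55` (`x`-loop),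
`60–75` (`y`-loop). -/

/-- The emulator layout used by the reduction. [folklore] -/
def lay : Layout := ⟨10, 11, 12, 13, 14, 15, 16⟩

/-! ### Setup -/

/-- **Setup, part A1**: read `n, d`; the parameters `d', L, κ₁, ℓx, ℓy, κ₂`, the periods, the
lengths `|x|, |y|, Ny`, `M₁, M₂`, the base `B₀` of the `B`-bits, and the base `Bv = X + |input|` of
the emulated cells. (`setupA2`: the threshold `thr' = n ρ₁' + n σ₃` with `ρ₁' = σ₁ + 2d' + 2`,
`σ₁ = L M₁ - (3 (L-1) L + 4d')`, `σ₃ = ℓx M₂ - (3 κ₁ M₁ + 2 (3 (L-1) L + 4d'))`, and `r30 := Ny`,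
`r31 := 0` for the size loop.) [folklore] -/
def setupA1 : SProg := block [
  (.band, r 2, pt 0, pt 0),
  (.add, r 54, r 0, im 1), (.band, r 3, pt 54, pt 54),
  (.add, r 4, r 3, im 1),
  (.mul, r 5, r 4, im 2),
  (.mul, r 6, r 4, im 16), (.add, r 6, r 6, im 1),
  (.mul, r 7, r 4, im 52), (.add, r 7, r 7, im 3),
  (.mul, r 8, r 4, im 34), (.add, r 8, r 8, im 2),
  (.mul, r 9, r 4, im 344), (.add, r 9, r 9, im 21),
  (.add, r 18, r 7, r 9), (.add, r 19, r 8, r 9), (.add, r 26, r 5, r 6),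
  (.mul, r 22, r 2, r 18), (.mul, r 22, r 22, im 2), (.add, r 22, r 22, r 9),
  (.mul, r 23, r 2, r 19), (.add, r 23, r 23, r 9),
  (.add, r 24, r 22, r 23), (.add, r 24, r 24, im 1),
  (.mul, r 20, r 4, im 12), (.sub, r 20, r 20, im 3), (.mul, r 20, r 20, im 2),
  (.mul, r 21, r 20, im 2),
  (.mul, r 27, r 2, r 3), (.add, r 27, r 27, r 0), (.add, r 27, r 27, im 2),
  (.sub, r 30, r 1, im 100), (.add, r 10, r 0, r 30)]

/-- **Setup, part A2**: the threshold register `thr' = n ρ₁' + n σ₃` and the size-loop registers.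
[folklore] -/
def setupA2 : SProg := block [
  -- sumVG = 3 (L - 1) L + 4d' in r54
  (.sub, r 54, r 5, im 1), (.mul, r 54, r 54, r 5), (.mul, r 54, r 54, im 3),
  (.mul, r 55, r 4, im 4), (.add, r 54, r 54, r 55),
  -- ρ₁' = L M₁ - sumVG + 2d' + 2 in r55; thr' := n ρ₁'
  (.mul, r 55, r 5, r 20), (.sub, r 55, r 55, r 54), (.add, r 55, r 55, r 4), (.add, r 55, r 55, r 4),
  (.add, r 55, r 55, im 2), (.mul, r 25, r 2, r 55),
  -- σ₃ = ℓx M₂ - (3 κ₁ M₁ + 2 sumVG) in r55; thr' += n σ₃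
  (.mul, r 53, r 6, r 20), (.mul, r 53, r 53, im 3), (.mul, r 54, r 54, im 2), (.add, r 53, r 53, r 54),
  (.mul, r 55, r 7, r 21), (.sub, r 55, r 55, r 53), (.mul, r 55, r 2, r 55), (.add, r 25, r 25, r 55),
  (.band, r 30, r 24, r 24), (.band, r 31, im 0, im 0)]

/-- **Setup, part A** = `setupA1; setupA2`. [folklore] -/
def setupA : SProg := seqs [setupA1, setupA2]

/-- **Setup, part 2**: `r31 := Nat.size Ny` by halving `r30`. [folklore] -/
def sizeLoop : SProg :=
  whilenz (r 30) (block [(.shr, r 30, r 30, im 1), (.add, r 31, r 31, im 1)])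

/-- **Setup, part B**: `ws := kD · size`, `Pw := 2^ws`, `V := max (Pw - 1) (max cD Ny)` (`cD`
the largest constant of the DTW program), `Sv := Bv + V + 1`, `Gv := 0`. [folklore] -/
def setupB (kD cD : ℕ) : SProg := seqs [
  block [(.mul, r 31, r 31, im kD), (.shl, r 13, im 1, r 31), (.sub, r 32, r 13, im 1),
    (.lt, r 33, r 32, im cD)],
  ifz (r 33) skip (block [(.band, r 32, im cD, im cD)]),
  block [(.lt, r 33, r 32, r 24)],
  ifz (r 33) skip (block [(.band, r 32, r 24, r 24)]),
  block [(.add, r 11, r 10, r 32), (.add, r 11, r 11, im 1), (.band, r 12, im 0, im 0)]]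

/-! ### Writing the first curve -/

/-- The point of a vector gadget from `q = r49` (`ℓ = r50`, parity `r51`) and the bit `r52`:
`r53 := 6 q + 1 + 2 (bit xor parity)`. [folklore] -/
def xPoint : SProg := block [
  (.mul, r 53, r 49, im 6), (.bxor, r 54, r 52, r 51), (.mul, r 54, r 54, im 2), (.add, r 54, r 54, im 1),
  (.add, r 53, r 53, r 54)]

/-- Inside the vector gadgets of an `x`-side normalised vector gadget: `ℓ, parity`; the bit is
`[ℓ = d]` for the extra vector `e` (inner index `r48 = 0`) and `A (k mod n) ℓ` (`0` if `ℓ = d`)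
for `aᵢ 0`; then the point. [folklore] -/
def xVector : SProg := seqs [
  block [(.div, r 50, r 49, im 2), (.mod, r 51, r 49, im 2)],
  ifz (r 48)
    (block [(.eq, r 52, r 50, r 3)])
    (seqs [
      block [(.lt, r 43, r 50, r 3)],
      ifz (r 43) (block [(.band, r 52, im 0, im 0)])
        (block [(.mod, r 54, r 45, r 2), (.mul, r 54, r 54, r 3), (.add, r 54, r 54, r 50),
          (.add, r 54, r 54, r 0), (.add, r 54, r 54, im 2), (.band, r 52, pt 54, pt 54)])]),
  xPoint]

/-- Inside an `x`-side normalised vector gadget at offset `r = r46 ≥ κ₁`: decode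
`r - κ₁ = k' (L + κ₁) + q`; a block of `M₁` if `q ≥ L`, else the vector gadget. [folklore] -/
def xGadget : SProg := seqs [
  block [(.sub, r 47, r 46, r 6), (.div, r 48, r 47, r 26), (.mod, r 49, r 47, r 26), (.lt, r 43, r 49, r 5)],
  ifz (r 43) (block [(.band, r 53, r 20, r 20)]) xVector]

/-- Past the leading block of the first curve (`p = r40 ≥ κ₂`): decode `p - κ₂ = k (ℓx + κ₂) + r`;
a block of `M₂` if `r ≥ ℓx`; inside the gadget a block of `M₁` if `r < κ₁`, else `xGadget`.
[folklore] -/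
def xRest : SProg := seqs [
  block [(.sub, r 44, r 40, r 9), (.div, r 45, r 44, r 18), (.mod, r 46, r 44, r 18), (.lt, r 43, r 46, r 7)],
  ifz (r 43) (block [(.band, r 53, r 21, r 21)])
    (seqs [block [(.lt, r 43, r 46, r 6)], ifz (r 43) xGadget (block [(.band, r 53, r 20, r 20)])])]

/-- **The body of the `x`-loop**: the point `ovXval p` of the first curve at `p = r40` into `r53`,
then doubled (the `encodeInt` of a natural number), reduced modulo `Pw`, stored at the pointer
`r42 = Bv + 2 + p`; advance. [folklore] -/
def xBody : SProg := seqs [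
  block [(.lt, r 43, r 40, r 9)],
  ifz (r 43) xRest (block [(.band, r 53, r 21, r 21)]),
  block [(.mul, r 53, r 53, im 2), (.mod, r 53, r 53, r 13), (.band, pt 42, r 53, r 53),
    (.add, r 42, r 42, im 1), (.add, r 40, r 40, im 1), (.sub, r 41, r 41, im 1)]]

/-- **The `x`-loop**: all points of the first curve. [folklore] -/
def xLoop : SProg := seqs [
  block [(.band, r 40, im 0, im 0), (.band, r 41, r 22, r 22), (.add, r 42, r 10, im 2)],
  whilenz (r 41) xBody]

/-! ### Writing the second curve -/

/-- The point of a `y`-side vector gadget from `q = r69` (`ℓ = r70`, parity `r71`) and the bit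
`r72`: `r73 := 6 q + 2 - 2 (bit ∧ ¬parity)`. [folklore] -/
def yPoint : SProg := block [
  (.mul, r 73, r 69, im 6), (.add, r 73, r 73, im 2), (.bxor, r 74, r 71, im 1), (.band, r 74, r 74, r 72),
  (.mul, r 74, r 74, im 2), (.sub, r 73, r 73, r 74)]

/-- Inside the vector gadget of a `y`-side normalised vector gadget: `ℓ, parity`; the bit is
`B j ℓ` for `ℓ < d` and `1` for `ℓ = d` (`bⱼ 1`); then the point. [folklore] -/
def yVector : SProg := seqs [
  block [(.div, r 70, r 69, im 2), (.mod, r 71, r 69, im 2), (.lt, r 63, r 70, r 3)],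
  ifz (r 63) (block [(.band, r 72, im 1, im 1)])
    (block [(.mul, r 74, r 65, r 3), (.add, r 74, r 74, r 70), (.add, r 74, r 74, r 27),
      (.band, r 72, pt 74, pt 74)]),
  yPoint]

/-- Inside a `y`-side normalised vector gadget at offset `r = r66 ≥ κ₁`. [folklore] -/
def yGadget : SProg := seqs [
  block [(.sub, r 67, r 66, r 6), (.mod, r 69, r 67, r 26), (.lt, r 63, r 69, r 5)],
  ifz (r 63) (block [(.band, r 73, r 20, r 20)]) yVector]

/-- Past the leading block of the second curve (`q = r60 ≥ κ₂`). [folklore] -/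
def yRest : SProg := seqs [
  block [(.sub, r 64, r 60, r 9), (.div, r 65, r 64, r 19), (.mod, r 66, r 64, r 19), (.lt, r 63, r 66, r 8)],
  ifz (r 63) (block [(.band, r 73, r 21, r 21)])
    (seqs [block [(.lt, r 63, r 66, r 6)], ifz (r 63) yGadget (block [(.band, r 73, r 20, r 20)])])]

/-- **The body of the `y`-loop**: the point `ovYval q` of the second curve at `q = r60` into
`r73`, doubled, reduced modulo `Pw`, stored at `r62 = Bv + 2 + |x| + q`; advance. [folklore] -/
def yBody : SProg := seqs [
  block [(.lt, r 63, r 60, r 9)],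
  ifz (r 63) yRest (block [(.band, r 73, r 21, r 21)]),
  block [(.mul, r 73, r 73, im 2), (.mod, r 73, r 73, r 13), (.band, pt 62, r 73, r 73),
    (.add, r 62, r 62, im 1), (.add, r 60, r 60, im 1), (.sub, r 61, r 61, im 1)]]

/-- **The `y`-loop**: all points of the second curve. [folklore] -/
def yLoop : SProg := seqs [
  block [(.band, r 60, im 0, im 0), (.band, r 61, r 23, r 23), (.add, r 62, r 10, im 2), (.add, r 62, r 62, r 22)],
  whilenz (r 61) yBody]

/-! ### Header, register clearing, read-out -/

/-- The header of the emulated input: cell `0` holds `Ny = |x| + |y| + 1`, cell `1` holds `|x|`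
(both mod `Pw`). [folklore] -/
def header : SProg := block [
  (.mod, r 30, r 24, r 13), (.band, pt 10, r 30, r 30),
  (.mod, r 30, r 22, r 13), (.add, r 31, r 10, im 1), (.band, pt 31, r 30, r 30)]

/-- The registers cleared at the end of the build: all cells `< 100` except the four environment
registers `10–13` and the threshold register `25`. [folklore] -/
def clearedRegs : List ℕ :=
  (List.range 100).filter fun i => ¬ ((10 ≤ i ∧ i ≤ 13) ∨ i = 25)

/-- Clear the scratch registers. [folklore] -/
def clearRegs : SProg := block (clearedRegs.map fun i => (.band, r i, im 0, im 0))

/-- **The build**: relocate the input, set up the parameters and the emulator environment, write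
the two curves and the header of the emulated `DTW` input, clear the scratch. (`kD`, `cD`:
word-size constant and largest constant of the DTW program.) [folklore] -/
def pre (kD cD : ℕ) : SProg := seqs [
  relocate, setupA, sizeLoop, setupB kD cD, xLoop, yLoop, header, clearRegs]

/-- **The read-out**: the DTW program's answer `v` is the emulated cell `1`; output the bit
`[v + 1 < thr']` (= `[v ≤ thr I]` for `n ≥ 1`, and `0` for `n = 0` since then `thr' = 0`).
[folklore] -/
def post : SProg := block [
  (.add, r 17, r 10, im 1), (.band, r 17, pt 17, pt 17), (.add, r 17, r 17, im 1),
  (.lt, r 1, r 17, r 25), (.band, r 0, im 1, im 1)]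

/-- **The reduction program**: Orthogonal Vectors by one emulated run of the DTW program `M`.
[folklore] -/
def reduction (M : Program) (kD : ℕ) : Program :=
  withSubrun (pre kD M.maxConst) lay M post

/-- The build is query-free. [folklore] -/
theorem pre_queryFree (kD cD : ℕ) : (pre kD cD).QueryFree := by
  refine seqs_queryFree ?_
  simp only [List.mem_cons, List.not_mem_nil, or_false]
  rintro s (rfl | rfl | rfl | rfl | rfl | rfl | rfl | rfl)
  · exact relocate_queryFree
  · exact ⟨block_queryFree _, block_queryFree _, trivial⟩
  · exact ⟨trivial, block_queryFree _⟩
  · simp [setupB, seqs, QueryFree, block_queryFree]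
  · simp [xLoop, xBody, xRest, xGadget, xVector, xPoint, seqs, QueryFree, block_queryFree]
  · simp [yLoop, yBody, yRest, yGadget, yVector, yPoint, seqs, QueryFree, block_queryFree]
  · exact block_queryFree _
  · exact block_queryFree _

/-- The read-out is query-free. [folklore] -/
theorem post_queryFree : post.QueryFree := block_queryFree _

/-- The reduction program is deterministic. [folklore] -/
theorem reduction_isDeterministic (M : Program) (kD : ℕ) : (reduction M kD).IsDeterministic :=
  withSubrun_isDeterministic _ _ _ _

/-- The reduction program is oracle-free. [folklore] -/
theorem reduction_isOracleFree (M : Program) (kD : ℕ) : (reduction M kD).IsOracleFree :=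
  withSubrun_isOracleFree (pre_queryFree _ _) post_queryFree _ _

end Prog

end DTWRed

end Literature.Computability.FineGrained

namespace Literature.Computability.FineGrained

open Cryptography Cryptography.WordRAM Cryptography.WordRAM.SProg

namespace DTWRed

namespace Prog

/-! ### Ghost parameters of a run -/

/-- The data of a run of the reduction: the OV instance and the word-size constant `kD` and the
largest constant `cD` of the DTW program. [folklore] -/
structure Params where
  /-- The OV instance. -/
  I : OVInstance
  /-- The word-size constant of the DTW program. -/
  kD : ℕ
  /-- The largest constant of the DTW program. -/
  cD : ℕ

namespace Params

noncomputable section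

variable (g : Params)

/-- The input words: the `OV` encoding of the instance. [folklore] -/
def x : List ℕ := OV.encode g.I
/-- The input length `Lx = 2 + 2 n d`. [folklore] -/
def Lx : ℕ := g.x.length
/-- The base `X` of the relocated input. [folklore] -/
def X : ℕ := g.Lx + 101
/-- `n`. [folklore] -/
def n : ℕ := g.I.n
/-- `d`. [folklore] -/
def d : ℕ := g.I.d
/-- `d' = d + 1`. [folklore] -/
def dd : ℕ := DTWRed.dd g.I.d
/-- `L = 2 d'`. [folklore] -/
def L : ℕ := Lv g.I.d
/-- `κ₁`. [folklore] -/
def K1 : ℕ := κ₁ g.I.d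
/-- `ℓx`. [folklore] -/
def LX : ℕ := ℓx₃ g.I.d
/-- `ℓy`. [folklore] -/
def LY : ℕ := ℓy₃ g.I.d
/-- `κ₂`. [folklore] -/
def K2 : ℕ := κ₂ g.I.d
/-- The period `ℓx + κ₂` of the first curve. [folklore] -/
def per : ℕ := g.LX + g.K2
/-- The period `ℓy + κ₂` of the second curve. [folklore] -/
def perY : ℕ := g.LY + g.K2
/-- The inner period `L + κ₁` of the normalised vector gadgets. [folklore] -/
def LK : ℕ := g.L + g.K1
/-- `M₁`. [folklore] -/
def M1 : ℕ := M₁ g.I.d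
/-- `M₂`. [folklore] -/
def M2 : ℕ := M₂ g.I.d
/-- `|x|`, the length of the first curve. [folklore] -/
def lenX : ℕ := (ovX g.I).length
/-- `|y|`, the length of the second curve. [folklore] -/
def lenY : ℕ := (ovY g.I).length
/-- `Ny = |x| + |y| + 1`, the length of the emulated input. [folklore] -/
def Ny : ℕ := g.lenX + g.lenY + 1
/-- The base `B₀ = X + 2 + n d` of the `B`-bits in the relocated input. [folklore] -/
def B0 : ℕ := g.n * g.d + g.X + 2
/-- `sumVG = 3 (L - 1) L + 4 d'` as a natural number. [folklore] -/
def SVG : ℕ := (g.L - 1) * g.L * 3 + g.dd * 4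
/-- `ρ₁' = L M₁ - sumVG + 2 d' + 2` as a natural number. [folklore] -/
def rho1 : ℕ := g.L * g.M1 - g.SVG + g.dd + g.dd + 2
/-- `3 κ₁ M₁ + 2 sumVG`. [folklore] -/
def SNVG : ℕ := g.K1 * g.M1 * 3 + g.SVG * 2
/-- `σ₃ = ℓx M₂ - (3 κ₁ M₁ + 2 sumVG)` as a natural number. [folklore] -/
def sig3 : ℕ := g.LX * g.M2 - g.SNVG
/-- The threshold register `thr' = n ρ₁' + n σ₃`. [folklore] -/
def thr' : ℕ := g.n * g.rho1 + g.n * g.sig3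
/-- Base of the emulated cells: right above the relocated input. [folklore] -/
def Bv : ℕ := g.X + g.Lx
/-- The emulated word size `ws = kD · size Ny`. [folklore] -/
def ws : ℕ := g.kD * Nat.size g.Ny
/-- The emulated modulus `Pw = 2^ws`. [folklore] -/
def Pw : ℕ := 2 ^ g.ws
/-- The value bound `V = max (Pw - 1) (max cD Ny)` of the emulation. [folklore] -/
def V : ℕ := max (g.Pw - 1) (max g.cD g.Ny)
/-- Base of the stamps. [folklore] -/
def Sv : ℕ := g.Bv + g.V + 1
/-- The emulator environment: cells at `Bv`, stamps at `Sv`, generation `0`, word size `ws`,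
region size `V + 1`. [folklore] -/
def env : Env := ⟨g.Bv, g.Sv, 0, g.ws, g.V + 1⟩
/-- The emulated input. [folklore] -/
def y : List ℕ := dtwInput g.I

/-! ### Arithmetic of the parameters -/

/-- `6 Σ_{ℓ < L} ℓ = 3 (L - 1) L`, so `sumVG = 3 (L-1) L + 4 d'`. [folklore] -/
theorem sumVG_eq (d : ℕ) : sumVG d = (((Lv d - 1) * Lv d * 3 + DTWRed.dd d * 4 : ℕ) : ℤ) := by
  unfold sumVG
  have h := Finset.sum_range_id_mul_two (Lv d)
  have hs : (∑ ℓ ∈ Finset.range (Lv d), ((0 : ℕ) + (ℓ : ℤ))) = ((∑ ℓ ∈ Finset.range (Lv d), ℓ : ℕ) : ℤ) := by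
    push_cast; simp
  rw [hs]
  have h2 : ((∑ ℓ ∈ Finset.range (Lv d), ℓ : ℕ) : ℤ) * 2 = (((Lv d - 1) * Lv d : ℕ) : ℤ) := by
    rw [Nat.mul_comm (Lv d - 1)]; exact_mod_cast h
  push_cast at h2 ⊢
  linarith

/-- All parameters as polynomials in `d' - 1`. [folklore] -/
theorem poly : ∃ k : ℕ, g.dd = k + 1 ∧ g.L = 2 * k + 2 ∧ g.K1 = 16 * k + 17 ∧ g.LX = 52 * k + 55 ∧
    g.LY = 34 * k + 36 ∧ g.K2 = 344 * k + 365 ∧ g.M1 = 24 * k + 18 ∧ g.M2 = 48 * k + 36 ∧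
    g.SVG = 12 * (k * k) + 22 * k + 10 ∧ g.SNVG = 1176 * (k * k) + 2132 * k + 938 ∧
    g.LX * g.M2 = 2496 * (k * k) + 4512 * k + 1980 ∧ g.L * g.M1 = 48 * (k * k) + 84 * k + 36 := by
  obtain ⟨hdd, hL, -, -, -, hκ⟩ := params₁ g.I.d
  obtain ⟨-, -, -, h1, h2, h3⟩ := params₃ g.I.d
  refine ⟨DTWRed.dd g.I.d - 1, ?_⟩
  set k := DTWRed.dd g.I.d - 1 with hk
  have edd : g.dd = k + 1 := by show DTWRed.dd g.I.d = k + 1; omega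
  have eL : g.L = 2 * k + 2 := by show Lv g.I.d = _; rw [hL]; omega
  have eK1 : g.K1 = 16 * k + 17 := by show κ₁ g.I.d = _; rw [hκ, hL]; omega
  have eLX : g.LX = 52 * k + 55 := by show ℓx₃ g.I.d = _; rw [h1]; omega
  have eLY : g.LY = 34 * k + 36 := by show ℓy₃ g.I.d = _; rw [h2]; omega
  have eK2 : g.K2 = 344 * k + 365 := by show κ₂ g.I.d = _; rw [h3]; omega
  have eM1 : g.M1 = 24 * k + 18 := by show 2 * (12 * DTWRed.dd g.I.d - 3) = _; omega
  have eM2 : g.M2 = 48 * k + 36 := by show 2 * M₁ g.I.d = _; rw [show M₁ g.I.d = g.M1 from rfl, eM1]; omega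
  have eSVG : g.SVG = 12 * (k * k) + 22 * k + 10 := by
    unfold SVG; rw [eL, edd, show 2 * k + 2 - 1 = 2 * k + 1 by omega]; ring
  have eSNVG : g.SNVG = 1176 * (k * k) + 2132 * k + 938 := by
    unfold SNVG; rw [eSVG, eK1, eM1]; ring
  have eLM : g.LX * g.M2 = 2496 * (k * k) + 4512 * k + 1980 := by rw [eLX, eM2]; ring
  have eLM1 : g.L * g.M1 = 48 * (k * k) + 84 * k + 36 := by rw [eL, eM1]; ring
  exact ⟨edd, eL, eK1, eLX, eLY, eK2, eM1, eM2, eSVG, eSNVG, eLM, eLM1⟩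

/-- The natural-number forms of `σ₁`, `ρ₁'`, `σ₃` and the linear facts about the parameters used by
the symbolic execution. [folklore] -/
theorem arith : g.SVG ≤ g.L * g.M1 ∧ g.SNVG ≤ g.LX * g.M2 ∧ 1 ≤ g.L ∧ 12 ≤ g.dd * 12 ∧
    g.M1 = (g.dd * 12 - 3) * 2 ∧ g.M2 = g.M1 * 2 ∧ g.L = g.dd * 2 ∧ g.K1 = g.dd * 16 + 1 ∧
    g.LX = g.dd * 52 + 3 ∧ g.LY = g.dd * 34 + 2 ∧ g.K2 = g.dd * 344 + 21 ∧ g.dd = g.d + 1 ∧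
    (σ₁ g.I.d).toNat = g.L * g.M1 - g.SVG ∧ ρ₁N g.I.d = g.rho1 ∧ (σ₃ g.I.d).toNat = g.sig3 ∧
    g.lenX = g.K2 + 2 * g.n * g.per ∧ g.lenY = g.K2 + g.n * g.perY ∧ g.M2 ≤ g.K2 := by
  obtain ⟨k, edd, eL, eK1, eLX, eLY, eK2, eM1, eM2, eSVG, eSNVG, eLM, eLM1⟩ := g.poly
  have hSVG : g.SVG ≤ g.L * g.M1 := by rw [eSVG, eLM1]; omega
  have hSNVG : g.SNVG ≤ g.LX * g.M2 := by rw [eSNVG, eLM]; omega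
  have hsum : sumVG g.I.d = (g.SVG : ℤ) := sumVG_eq g.I.d
  have hσ1 : (σ₁ g.I.d).toNat = g.L * g.M1 - g.SVG := by
    apply Int.ofNat.inj
    rw [Int.ofNat_eq_natCast, Int.toNat_of_nonneg (σ₁_nonneg g.I.d), Int.ofNat_eq_natCast, Nat.cast_sub hSVG,
      Nat.cast_mul]
    unfold σ₁; rw [hsum]; rfl
  have hρ1 : ρ₁N g.I.d = g.rho1 := by
    unfold ρ₁N rho1; rw [hσ1]
    show _ + (2 * g.dd + 2) = _; omega
  have hσ3 : (σ₃ g.I.d).toNat = g.sig3 := by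
    have h0 := (skipCost_nvgX (a := List.replicate g.I.d false) (d := g.I.d) (by simp)).2
    apply Int.ofNat.inj
    rw [Int.ofNat_eq_natCast, Int.toNat_of_nonneg h0, Int.ofNat_eq_natCast]
    unfold sig3; rw [Nat.cast_sub hSNVG]
    unfold σ₃ sumNVG; rw [hsum]
    show (g.LX : ℤ) * (g.M2 : ℤ) - (3 * (g.K1 : ℤ) * (g.M1 : ℤ) + 2 * (g.SVG : ℤ)) = _
    unfold SNVG; push_cast; ring
  refine ⟨hSVG, hSNVG, by omega, by omega, by omega, by omega, by omega, by omega, by omega, by omega,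
    by omega, edd.trans (by show k + 1 = g.d + 1; have : g.dd = g.d + 1 := rfl; omega), hσ1, hρ1, hσ3,
    length_ovX g.I, length_ovY g.I, by omega⟩

/-- **The threshold register decides OV**: `thr' = thr I + 2` for `n ≥ 1`, and `thr' = 0` for
`n = 0`. [folklore] -/
theorem thr'_eq : (1 ≤ g.n → g.thr' = thr g.I + 2) ∧ (g.n = 0 → g.thr' = 0) := by
  obtain ⟨-, -, -, -, -, -, -, -, -, -, -, -, -, hρ1, hσ3, -⟩ := g.arith
  refine ⟨fun hn => ?_, fun hn => by unfold thr'; rw [hn]; simp⟩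
  unfold thr' thr
  rw [← hρ1, ← hσ3]
  show g.I.n * ρ₁N g.I.d + g.I.n * (σ₃ g.I.d).toNat =
    g.I.n * (σ₃ g.I.d).toNat + (g.I.n - 1) * ρ₁N g.I.d + ρ₀N g.I.d + 2
  have hρ : ρ₁N g.I.d = ρ₀N g.I.d + 2 := by unfold ρ₁N ρ₀N; omega
  obtain ⟨k, hk⟩ := Nat.exists_eq_add_of_le (show 1 ≤ g.I.n from hn)
  rw [hk, show 1 + k - 1 = k by omega, hρ]; ring

/-- **The read-out test**: `v + 1 < thr' ↔` (`n ≥ 1` and `v ≤ thr I`). [folklore] -/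
theorem lt_thr'_iff (v : ℕ) : v + 1 < g.thr' ↔ 1 ≤ g.n ∧ v ≤ thr g.I := by
  obtain ⟨h1, h0⟩ := g.thr'_eq
  rcases Nat.eq_zero_or_pos g.n with hn | hn
  · rw [h0 hn]; omega
  · rw [h1 hn]; omega

/-! ### The chain of bases and the word-size requirement -/

/-- `Lx = 2 + 2 n d`. [folklore] -/
theorem Lx_eq : g.Lx = 2 + 2 * (g.n * g.d) := length_OV_encode g.I

/-- **Word-size requirements** of a run at word size `W`: the stamps fit, the emulated word size
is below `W`, the input width is at most `W`, and the arithmetic of the threshold fits. [folklore] -/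
structure Fits (W : ℕ) : Prop where
  top : g.Sv + g.V + 1 ≤ 2 ^ W
  ws_lt : g.ws < W
  width : inputWidth g.x ≤ W
  arith : (g.n + 1) * (g.LX * g.M2) < 2 ^ W

/-- Under `Fits`, the input words fit. [folklore] -/
theorem Fits.input {g : Params} {W : ℕ} (h : g.Fits W) : ∀ v ∈ g.x, v < 2 ^ W := fun v hv =>
  lt_of_lt_of_le (lt_two_pow_inputWidth_of_mem g.x v hv) (Nat.pow_le_pow_right Nat.two_pos h.width)

end

end Params

end Prog

end DTWRed

end Literature.Computability.FineGrained

namespace Literature.Computability.FineGrained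

open Cryptography Cryptography.WordRAM Cryptography.WordRAM.SProg

namespace DTWRed

namespace Prog

/-! ### Generic helpers -/

/-- The block rule from a memory split as `merge m m`, the result named. [folklore] -/
theorem achieves_block_of_eq {W : ℕ} {O : List ℕ → List ℕ} {ops : List OpSpec} {m : ℕ → ℕ}
    {Q : (ℕ → ℕ) → Prop} {T : ℕ} (h : ∀ m', m' = execOps W (merge m m) ops → Q m')
    (hT : ops.length ≤ T) : Achieves W O (block ops) m Q T := by
  have := h _ rfl; rw [merge_self] at this; exact Achieves.block this hT

namespace Params

variable (g : Params) {W : ℕ} {O : List ℕ → List ℕ}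

/-! ### Register conventions -/

/-- The registers after the setup. [folklore] -/
structure Regs (m : ℕ → ℕ) : Prop where
  r0 : m 0 = g.X
  r2 : m 2 = g.n
  r3 : m 3 = g.d
  r4 : m 4 = g.dd
  r5 : m 5 = g.L
  r6 : m 6 = g.K1
  r7 : m 7 = g.LX
  r8 : m 8 = g.LY
  r9 : m 9 = g.K2
  r10 : m 10 = g.Bv
  r18 : m 18 = g.per
  r19 : m 19 = g.perY
  r20 : m 20 = g.M1
  r21 : m 21 = g.M2
  r22 : m 22 = g.lenX
  r23 : m 23 = g.lenY
  r24 : m 24 = g.Ny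
  r25 : m 25 = g.thr'
  r26 : m 26 = g.LK
  r27 : m 27 = g.B0

/-- The environment registers: `Sv, Gv = 0, Pw`. [folklore] -/
structure ERegs (m : ℕ → ℕ) : Prop where
  r11 : m 11 = g.Sv
  r12 : m 12 = 0
  r13 : m 13 = g.Pw

variable {g}

/-- `Regs` survives changes outside `0–10` and `18–27`. [folklore] -/
theorem Regs.of_frame {m m' : ℕ → ℕ} (h : g.Regs m)
    (hf : ∀ a, a ≤ 10 ∨ (18 ≤ a ∧ a ≤ 27) → m' a = m a) : g.Regs m' :=
  ⟨(hf 0 (by omega)).trans h.r0, (hf 2 (by omega)).trans h.r2, (hf 3 (by omega)).trans h.r3,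
    (hf 4 (by omega)).trans h.r4, (hf 5 (by omega)).trans h.r5, (hf 6 (by omega)).trans h.r6,
    (hf 7 (by omega)).trans h.r7, (hf 8 (by omega)).trans h.r8, (hf 9 (by omega)).trans h.r9,
    (hf 10 (by omega)).trans h.r10, (hf 18 (by omega)).trans h.r18, (hf 19 (by omega)).trans h.r19,
    (hf 20 (by omega)).trans h.r20, (hf 21 (by omega)).trans h.r21, (hf 22 (by omega)).trans h.r22,
    (hf 23 (by omega)).trans h.r23, (hf 24 (by omega)).trans h.r24, (hf 25 (by omega)).trans h.r25,
    (hf 26 (by omega)).trans h.r26, (hf 27 (by omega)).trans h.r27⟩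

/-- `ERegs` survives changes outside `11–13`. [folklore] -/
theorem ERegs.of_frame {m m' : ℕ → ℕ} (h : g.ERegs m) (hf : ∀ a, 11 ≤ a → a ≤ 13 → m' a = m a) :
    g.ERegs m' :=
  ⟨(hf 11 (by omega) (by omega)).trans h.r11, (hf 12 (by omega) (by omega)).trans h.r12,
    (hf 13 (by omega) (by omega)).trans h.r13⟩

variable (g)

/-! ### Reading the relocated input -/

/-- `2 ≤ Lx`. [folklore] -/
theorem two_le_Lx : 2 ≤ g.Lx := by rw [g.Lx_eq]; omega

/-- The chain of bases. [folklore] -/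
theorem bases : 100 < g.X ∧ g.X = g.Lx + 101 ∧ g.X + g.Lx = g.Bv ∧ g.Bv + g.V + 1 = g.Sv := by
  refine ⟨by unfold X; omega, rfl, rfl, rfl⟩

/-- `Ny ≤ V`, `cD ≤ V`, `Pw - 1 ≤ V`. [folklore] -/
theorem le_V : g.Ny ≤ g.V ∧ g.cD ≤ g.V ∧ g.Pw - 1 ≤ g.V :=
  ⟨le_max_of_le_right (le_max_right _ _), le_max_of_le_right (le_max_left _ _), le_max_left _ _⟩

/-- Cell `0` after relocation holds `X`. [folklore] -/
@[simp] theorem relocated_zero' : relocated g.x 0 = g.X := by rw [relocated_zero]; rfl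

/-- Cell `1` after relocation holds `X - 1`. [folklore] -/
@[simp] theorem relocated_one' : relocated g.x 1 = g.X - 1 := by rw [relocated_one]; unfold X Lx; omega

/-- The relocated input: `x[j]` sits in cell `X + j` (and `0` past the input). [folklore] -/
theorem relocated_X_add (j : ℕ) : relocated g.x (g.X + j) = g.x.getD j 0 := by
  by_cases hj : j < g.Lx
  · have := relocated_base_add g.x (i := j + 1) (by omega) (by unfold Lx at hj; omega)
    rw [show g.x.length + 100 + (j + 1) = g.X + j by unfold X Lx; omega] at this
    rw [this]; rfl
  · rw [relocated_of_lt g.x (by unfold X Lx at *; omega), List.getD_eq_default _ _ (by unfold Lx at hj; omega)]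

/-- Everything above the relocated input is `0`. [folklore] -/
theorem relocated_of_Bv_le {a : ℕ} (ha : g.Bv ≤ a) : relocated g.x a = 0 :=
  relocated_of_lt g.x (by unfold Bv X Lx at ha; omega)

/-- Word `0` of the input is `n`. [folklore] -/
theorem x_getD_zero : g.x.getD 0 0 = g.n := by
  unfold x n; rw [List.getD_eq_getElem?_getD, OV_encode_getElem?_zero]; rfl

/-- Word `1` of the input is `d`. [folklore] -/
theorem x_getD_one : g.x.getD 1 0 = g.d := by
  unfold x d; rw [List.getD_eq_getElem?_getD, OV_encode_getElem?_one]; rfl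

/-- The `A`-bits in the input: `x[2 + i d + ℓ] = A i ℓ`. [folklore] -/
theorem x_getD_A {i ℓ : ℕ} (hi : i < g.n) (hℓ : ℓ < g.d) : g.x.getD (2 + (i * g.d + ℓ)) 0 = (abit g.I i ℓ).toNat := by
  unfold x abit
  rw [List.getD_eq_getElem?_getD, dif_pos ⟨hi, hℓ⟩]
  have := OV_encode_getElem?_A g.I ⟨i, hi⟩ ⟨ℓ, hℓ⟩
  simp only at this
  rw [show g.d = g.I.d from rfl, this]; rfl

/-- The `B`-bits in the input: `x[2 + n d + j d + ℓ] = B j ℓ`. [folklore] -/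
theorem x_getD_B {j ℓ : ℕ} (hj : j < g.n) (hℓ : ℓ < g.d) :
    g.x.getD (2 + (g.n * g.d + (j * g.d + ℓ))) 0 = (bbit g.I j ℓ).toNat := by
  unfold x bbit
  rw [List.getD_eq_getElem?_getD, dif_pos ⟨hj, hℓ⟩]
  have := OV_encode_getElem?_B g.I ⟨j, hj⟩ ⟨ℓ, hℓ⟩
  simp only at this
  rw [show g.d = g.I.d from rfl, show g.n = g.I.n from rfl, this]; rfl

/-! ### The standard facts under `Fits` -/

/-- **The standard facts** about the ghost parameters under `Fits`: the chain of bases, the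
fold equations of the computed quantities (oriented as the program computes them), and the
bounds of every product occurring in the setup. [folklore] -/
theorem facts (hF : g.Fits W) :
    -- bases
    100 < g.X ∧ g.X = g.Lx + 101 ∧ g.X + g.Lx = g.Bv ∧ g.Bv + g.V + 1 = g.Sv ∧ g.Sv + g.V + 1 ≤ 2 ^ W ∧
    g.Ny ≤ g.V ∧ g.Pw ≤ g.V + 1 ∧ g.cD ≤ g.V ∧ 2 + 2 * (g.n * g.d) = g.Lx ∧
    -- fold equations
    g.d + 1 = g.dd ∧ g.dd * 2 = g.L ∧ g.dd * 16 + 1 = g.K1 ∧ g.dd * 52 + 3 = g.LX ∧ g.dd * 34 + 2 = g.LY ∧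
    g.dd * 344 + 21 = g.K2 ∧ g.LX + g.K2 = g.per ∧ g.LY + g.K2 = g.perY ∧ g.L + g.K1 = g.LK ∧
    g.n * g.per * 2 + g.K2 = g.lenX ∧ g.n * g.perY + g.K2 = g.lenY ∧ g.lenX + g.lenY + 1 = g.Ny ∧
    (g.dd * 12 - 3) * 2 = g.M1 ∧ g.M1 * 2 = g.M2 ∧ g.n * g.d + g.X + 2 = g.B0 ∧
    (g.L - 1) * g.L * 3 + g.dd * 4 = g.SVG ∧ g.L * g.M1 - g.SVG + g.dd + g.dd + 2 = g.rho1 ∧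
    g.K1 * g.M1 * 3 + g.SVG * 2 = g.SNVG ∧ g.LX * g.M2 - g.SNVG = g.sig3 ∧ g.n * g.rho1 + g.n * g.sig3 = g.thr' ∧
    -- bounds of the products
    12 ≤ g.dd * 12 ∧ g.SVG ≤ g.L * g.M1 ∧ g.SNVG ≤ g.LX * g.M2 ∧ 1 ≤ g.L ∧
    g.n * (g.LX * g.M2) + g.LX * g.M2 < 2 ^ W ∧ g.L * g.M1 + 2 * g.dd + 2 ≤ g.LX * g.M2 ∧
    g.n * g.rho1 + g.n * g.sig3 ≤ g.n * (g.LX * g.M2) ∧ g.K2 ≤ g.LX * g.M2 ∧ g.LX ≤ g.LX * g.M2 ∧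
    g.M2 ≤ g.K2 ∧ g.n * g.rho1 ≤ g.n * (g.LX * g.M2) ∧ g.n * g.sig3 ≤ g.n * (g.LX * g.M2) := by
  obtain ⟨h1, h2, h3, h4⟩ := g.bases
  obtain ⟨hV1, hV2, hV3⟩ := g.le_V
  obtain ⟨hSVG, hSNVG, hL1, h12, eM1, eM2, eL, eK1, eLX, eLY, eK2, edd, -, -, -, hlenX, hlenY, hMK⟩ := g.arith
  obtain ⟨k, pdd, pL, pK1, pLX, pLY, pK2, pM1, pM2, pSVG, pSNVG, pLM, pLM1⟩ := g.poly
  have hA := hF.arith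
  have hrs : g.rho1 + g.sig3 ≤ g.LX * g.M2 := by
    unfold rho1 sig3; rw [pLM, pLM1, pSVG, pSNVG, pdd]; omega
  have hrho : g.L * g.M1 + 2 * g.dd + 2 ≤ g.LX * g.M2 := by rw [pLM, pLM1, pdd]; omega
  refine ⟨h1, h2, h3, h4, hF.top, hV1, by omega, hV2, g.Lx_eq.symm, edd.symm, eL.symm, eK1.symm, eLX.symm,
    eLY.symm, eK2.symm, rfl, rfl, rfl, by rw [hlenX]; ring, by rw [hlenY]; ring, rfl, eM1.symm,
    by rw [eM2], rfl, rfl, rfl, rfl, rfl, rfl, h12, hSVG, hSNVG, hL1, ?_, hrho, ?_, ?_, ?_, hMK, ?_, ?_⟩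
  · have : (g.n + 1) * (g.LX * g.M2) = g.n * (g.LX * g.M2) + g.LX * g.M2 := by ring
    rw [← this]; exact hA
  · rw [← Nat.mul_add]; exact Nat.mul_le_mul_left _ hrs
  · rw [pK2, pLM]; omega
  · rw [pLM, pLX]; omega
  · exact Nat.mul_le_mul_left _ (le_trans (Nat.le_add_right _ _) hrs)
  · exact Nat.mul_le_mul_left _ (le_trans (Nat.le_add_left _ _) hrs)

end Params

end Prog

end DTWRed

end Literature.Computability.FineGrained

namespace Literature.Computability.FineGrained

open Cryptography Cryptography.WordRAM Cryptography.WordRAM.SProg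

namespace DTWRed

namespace Prog

namespace Params

variable (g : Params) {W : ℕ} {O : List ℕ → List ℕ}

/-! ### The setup phase -/

/-- The registers after `setupA1`: everything of `Regs` except the threshold, and `r1 = X - 1`.
[folklore] -/
structure RegsA (m : ℕ → ℕ) : Prop where
  r0 : m 0 = g.X
  r1 : m 1 = g.X - 1
  r2 : m 2 = g.n
  r3 : m 3 = g.d
  r4 : m 4 = g.dd
  r5 : m 5 = g.L
  r6 : m 6 = g.K1
  r7 : m 7 = g.LX
  r8 : m 8 = g.LY
  r9 : m 9 = g.K2
  r10 : m 10 = g.Bv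
  r18 : m 18 = g.per
  r19 : m 19 = g.perY
  r20 : m 20 = g.M1
  r21 : m 21 = g.M2
  r22 : m 22 = g.lenX
  r23 : m 23 = g.lenY
  r24 : m 24 = g.Ny
  r26 : m 26 = g.LK
  r27 : m 27 = g.B0

/-- **Setup, part A1.** From the relocated memory, `setupA1` computes the registers `RegsA` and
does not touch the data. [folklore] -/
theorem setupA1_spec (hF : g.Fits W) :
    Achieves W O setupA1 (relocated g.x)
      (fun m => g.RegsA m ∧ ∀ a, 100 ≤ a → m a = relocated g.x a) 32 := by
  obtain ⟨hX, hXLx, hBv, hSv, htop, hNyV, hPwV, hcDV, hLx, edd, eL, eK1, eLX, eLY, eK2, eper, eperY, eLK,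
    elenX, elenY, eNy, eM1, eM2, eB0, eSVG, erho1, eSNVG, esig3, ethr, h12, hSVG, hSNVG, hL1, hA, hrho,
    hrs, hK2A, hLXA, hMK, hnrho, hnsig⟩ := g.facts hF
  have hread0 : relocated g.x g.X = g.n := by
    have := g.relocated_X_add 0; rw [Nat.add_zero, x_getD_zero] at this; exact this
  have hread1 : relocated g.x (g.X + 1) = g.d := by rw [g.relocated_X_add 1, x_getD_one]
  refine achieves_block_of_eq (fun m' hm' => ?_) (by simp [])
  simp (disch := first | omega | decide) only [execOps_cons, execOps_nil, execOp, Operand.write,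
    Operand.read, merge_apply_of_lt, merge_apply_of_le, update_merge_of_lt, Function.update_self,
    Function.update_of_ne, BinOp.eval_add_of_lt, BinOp.eval_sub_of_le, BinOp.eval_mul_of_lt,
    BinOp.eval_band, Nat.and_self, relocated_zero', relocated_one', hread0, hread1,
    edd, eL, eK1, eLX, eLY, eK2, eper, eperY, eLK, elenX, elenY, eNy, eM1, eM2, eB0] at hm'
  subst hm'
  refine ⟨⟨?_, ?_, ?_, ?_, ?_, ?_, ?_, ?_, ?_, ?_, ?_, ?_, ?_, ?_, ?_, ?_, ?_, ?_, ?_, ?_⟩, fun a ha => ?_⟩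
  all_goals (try simp (disch := first | omega | decide) only [merge_apply_of_lt,
    merge_apply_of_le, Function.update_self, Function.update_of_ne])
  all_goals (try simp only [relocated_zero', relocated_one'])
  all_goals omega


/-- **Setup, part A2.** From `RegsA`, `setupA2` computes the threshold register (so `Regs` holds),
`r30 = Ny`, `r31 = 0`, keeping `r1 = X - 1` and the data. [folklore] -/
theorem setupA2_spec (hF : g.Fits W) {m : ℕ → ℕ} (hR : g.RegsA m)
    (hD : ∀ a, 100 ≤ a → m a = relocated g.x a) :
    Achieves W O setupA2 m
      (fun m' => g.Regs m' ∧ m' 1 = g.X - 1 ∧ m' 30 = g.Ny ∧ m' 31 = 0 ∧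
        ∀ a, 100 ≤ a → m' a = relocated g.x a) 21 := by
  obtain ⟨hX, hXLx, hBv, hSv, htop, hNyV, hPwV, hcDV, hLx, edd, eL, eK1, eLX, eLY, eK2, eper, eperY, eLK,
    elenX, elenY, eNy, eM1, eM2, eB0, eSVG, erho1, eSNVG, esig3, ethr, h12, hSVG, hSNVG, hL1, hA, hrho,
    hrs, hK2A, hLXA, hMK, hnrho, hnsig⟩ := g.facts hF
  obtain ⟨r0, r1, r2, r3, r4, r5, r6, r7, r8, r9, r10, r18, r19, r20, r21, r22, r23, r24, r26, r27⟩ := hR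
  refine achieves_block_of_eq (fun m' hm' => ?_) (by simp [])
  simp (disch := first | omega | decide) only [execOps_cons, execOps_nil, execOp, Operand.write,
    Operand.read, merge_apply_of_lt, update_merge_of_lt, Function.update_self,
    Function.update_of_ne, BinOp.eval_add_of_lt, BinOp.eval_sub_of_le, BinOp.eval_mul_of_lt,
    BinOp.eval_band, Nat.and_self, r2, r4, r5, r6, r7, r20, r21, r24, eSVG, erho1, eSNVG, esig3,
    ethr] at hm'
  subst hm'
  refine ⟨⟨?_, ?_, ?_, ?_, ?_, ?_, ?_, ?_, ?_, ?_, ?_, ?_, ?_, ?_, ?_, ?_, ?_, ?_, ?_, ?_⟩, ?_, ?_, ?_, fun a ha => ?_⟩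
  all_goals (try simp (disch := first | omega | decide) only [merge_apply_of_lt,
    merge_apply_of_le, Function.update_self, Function.update_of_ne])
  all_goals first | assumption | (exact hD _ ha)

/-- **Setup, part 2: the size loop.** From `r30 = v`, `r31 = 0`, the loop ends with
`r31 = Nat.size v`, `r30 = 0`, all other cells unchanged, within `4 · size v + 1` steps.
[folklore] -/
theorem sizeLoop_spec {m : ℕ → ℕ} {v : ℕ} (h30 : m 30 = v) (h31 : m 31 = 0) (hv : v < 2 ^ W) :
    Achieves W O sizeLoop m
      (fun m' => m' 31 = Nat.size v ∧ m' 30 = 0 ∧ ∀ a, a ≠ 30 → a ≠ 31 → m' a = m a)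
      (Nat.size v * 4 + 1) := by
  have hsz : Nat.size v ≤ W := Nat.size_le.2 hv
  have hW : W < 2 ^ W := Nat.lt_two_pow_self
  refine Achieves.whilenz (Nat.size v) 2
    (fun i m' => m' 30 = v / 2 ^ i ∧ m' 31 = i ∧ ∀ a, a ≠ 30 → a ≠ 31 → m' a = m a)
    (fun i hi m' ⟨h1, h2, h3⟩ => ⟨?_, ?_⟩) (fun m' ⟨h1, _, _⟩ => ?_) ⟨by simpa using h30, h31,
    fun a _ _ => rfl⟩ (fun m' ⟨h1, h2, h3⟩ => ⟨h2, ?_, h3⟩) le_rfl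
  · have : 2 ^ i ≤ v := Nat.lt_size.1 hi
    simp only [Operand.read, h1]
    exact (Nat.div_pos this (Nat.two_pow_pos i)).ne'
  · refine achieves_block_of_eq (fun m'' hm'' => ?_) le_rfl
    simp (disch := first | omega | decide) only [execOps_cons, execOps_nil, execOp, Operand.write,
      Operand.read, merge_apply_of_lt, update_merge_of_lt, Function.update_of_ne,
      BinOp.eval_add_of_lt, BinOp.eval_shr, h1, h2] at hm''
    subst hm''
    refine ⟨?_, ?_, fun a ha1 ha2 => ?_⟩
    · (try simp (disch := first | omega | decide) only [merge_apply_of_lt, Function.update_self,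
      Function.update_of_ne])
      rw [Nat.shiftRight_eq_div_pow, Nat.div_div_eq_div_mul, ← pow_succ]
    · (try simp (disch := first | omega | decide) only [merge_apply_of_lt, Function.update_self])
    · by_cases ha : a < 100
      · rw [merge_apply_of_lt ha, Function.update_of_ne ha2, Function.update_of_ne ha1, h3 a ha1 ha2]
      · rw [merge_apply_of_le (by omega), h3 a ha1 ha2]
  · simp only [Operand.read, h1]
    exact Nat.div_eq_of_lt (Nat.lt_size_self v)
  · rw [h1]; exact Nat.div_eq_of_lt (Nat.lt_size_self v)

/-- **Setup, part B.** From the registers of `setupA` and `r31 = size Ny`, `setupB` sets the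
environment registers `Sv, Gv = 0, Pw` (`ERegs`), keeping `Regs` and the data. [folklore] -/
theorem setupB_spec (hF : g.Fits W) {m : ℕ → ℕ} (hR : g.Regs m) (h31 : m 31 = Nat.size g.Ny)
    (hD : ∀ a, 100 ≤ a → m a = relocated g.x a) :
    Achieves W O (setupB g.kD g.cD) m
      (fun m' => g.Regs m' ∧ g.ERegs m' ∧ ∀ a, 100 ≤ a → m' a = relocated g.x a) 16 := by
  obtain ⟨hX, hXLx, hBv, hSv, htop, hNyV, hPwV, hcDV, -⟩ := g.facts hF
  have hwsW : g.ws < W := hF.ws_lt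
  have hW : W < 2 ^ W := Nat.lt_two_pow_self
  have hws : Nat.size g.Ny * g.kD = g.ws := Nat.mul_comm _ _
  have hPw : 2 ^ g.ws = g.Pw := rfl
  have hPwW : g.Pw < 2 ^ W := Nat.pow_lt_pow_right (by norm_num) hwsW
  have hPw1 : 1 ≤ g.Pw := Nat.one_le_two_pow
  obtain ⟨r0, r2, r3, r4, r5, r6, r7, r8, r9, r10, r18, r19, r20, r21, r22, r23, r24, r25, r26, r27⟩ := hR
  unfold setupB
  -- block 1
  refine Achieves.seqs_cons (R := fun m₁ => m₁ 13 = g.Pw ∧ m₁ 32 = g.Pw - 1 ∧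
      m₁ 33 = (if g.Pw - 1 < g.cD then 1 else 0) ∧ ∀ a, a ≠ 13 → a ≠ 31 → a ≠ 32 → a ≠ 33 →
        m₁ a = m a) (T₁ := 4) (T₂ := 12) ?_ ?_
  · refine achieves_block_of_eq (fun m' hm' => ?_) le_rfl
    simp (disch := first | omega | decide) only [execOps_cons, execOps_nil, execOp, Operand.write,
      Operand.read, merge_apply_of_lt, update_merge_of_lt, Function.update_self,
      BinOp.eval_sub_of_le, BinOp.eval_mul_of_lt, BinOp.eval_shl_of_lt, BinOp.eval_lt,
      Nat.one_mul, h31, hws, hPw] at hm'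
    subst hm'
    refine ⟨?_, ?_, ?_, fun a h13 h31' h32 h33 => ?_⟩
    all_goals (try simp (disch := first | omega | decide) only [merge_apply_of_lt,
      Function.update_self, Function.update_of_ne])
    by_cases ha : a < 100
    · rw [merge_apply_of_lt ha]; simp (disch := omega) only [Function.update_of_ne]
    · rw [merge_apply_of_le (by omega)]
  rintro m₁ ⟨q13, q32, q33, qf⟩
  -- ifz 1: r32 := max (Pw - 1) cD
  refine Achieves.seqs_cons (R := fun m₂ => m₂ 13 = g.Pw ∧ m₂ 32 = max (g.Pw - 1) g.cD ∧
      ∀ a, a ≠ 13 → a ≠ 31 → a ≠ 32 → a ≠ 33 → m₂ a = m a) (T₁ := 3) (T₂ := 9) ?_ ?_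
  · refine Achieves.ifz (fun h0 => ?_) (fun h1 => ?_)
    · have hle : ¬ g.Pw - 1 < g.cD := by
        simp only [Operand.read, q33] at h0; intro h; simp [h] at h0
      refine Achieves.skip ⟨q13, by rw [q32, max_eq_left (Nat.not_lt.1 hle)], qf⟩
    · have hlt : g.Pw - 1 < g.cD := by simp only [Operand.read, q33] at h1; split_ifs at h1 <;> simp_all
      refine achieves_block_of_eq (fun m' hm' => ?_) le_rfl
      simp (disch := first | omega | decide) only [execOps_cons, execOps_nil, execOp, Operand.write,
        Operand.read, update_merge_of_lt, BinOp.eval_band, Nat.and_self] at hm'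
      subst hm'
      refine ⟨?_, ?_, fun a h13 h31' h32 h33 => ?_⟩
      · rw [merge_apply_of_lt (by omega), Function.update_of_ne (by omega), q13]
      · rw [merge_apply_of_lt (by omega), Function.update_self, max_eq_right hlt.le]
      · by_cases ha : a < 100
        · rw [merge_apply_of_lt ha, Function.update_of_ne h32, qf a h13 h31' h32 h33]
        · rw [merge_apply_of_le (by omega), qf a h13 h31' h32 h33]
  rintro m₂ ⟨s13, s32, sf⟩
  have s24 : m₂ 24 = g.Ny := (sf 24 (by omega) (by omega) (by omega) (by omega)).trans r24
  -- block: r33 := (r32 < Ny)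
  refine Achieves.seqs_cons (R := fun m₃ => m₃ 13 = g.Pw ∧ m₃ 32 = max (g.Pw - 1) g.cD ∧
      m₃ 33 = (if max (g.Pw - 1) g.cD < g.Ny then 1 else 0) ∧
      ∀ a, a ≠ 13 → a ≠ 31 → a ≠ 32 → a ≠ 33 → m₃ a = m a) (T₁ := 1) (T₂ := 8) ?_ ?_
  · refine achieves_block_of_eq (fun m' hm' => ?_) le_rfl
    simp (disch := first | omega | decide) only [execOps_cons, execOps_nil, execOp, Operand.write,
      Operand.read, merge_apply_of_lt, update_merge_of_lt, BinOp.eval_lt, s32, s24] at hm'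
    subst hm'
    refine ⟨?_, ?_, ?_, fun a h13 h31' h32 h33 => ?_⟩
    · rw [merge_apply_of_lt (by omega), Function.update_of_ne (by omega), s13]
    · rw [merge_apply_of_lt (by omega), Function.update_of_ne (by omega), s32]
    · rw [merge_apply_of_lt (by omega), Function.update_self]
    · by_cases ha : a < 100
      · rw [merge_apply_of_lt ha, Function.update_of_ne h33, sf a h13 h31' h32 h33]
      · rw [merge_apply_of_le (by omega), sf a h13 h31' h32 h33]
  rintro m₃ ⟨t13, t32, t33, tf⟩
  -- ifz 2: r32 := V
  refine Achieves.seqs_cons (R := fun m₄ => m₄ 13 = g.Pw ∧ m₄ 32 = g.V ∧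
      ∀ a, a ≠ 13 → a ≠ 31 → a ≠ 32 → a ≠ 33 → m₄ a = m a) (T₁ := 3) (T₂ := 5) ?_ ?_
  · have t24 : m₃ 24 = g.Ny := (tf 24 (by omega) (by omega) (by omega) (by omega)).trans r24
    refine Achieves.ifz (fun h0 => ?_) (fun h1 => ?_)
    · have hle : ¬ max (g.Pw - 1) g.cD < g.Ny := by
        simp only [Operand.read, t33] at h0; intro h; simp [h] at h0
      refine Achieves.skip ⟨t13, ?_, tf⟩
      rw [t32]; unfold V; rw [← max_assoc, max_eq_left (Nat.not_lt.1 hle)]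
    · have hlt : max (g.Pw - 1) g.cD < g.Ny := by
        simp only [Operand.read, t33] at h1; split_ifs at h1 <;> simp_all
      refine achieves_block_of_eq (fun m' hm' => ?_) le_rfl
      simp (disch := first | omega | decide) only [execOps_cons, execOps_nil, execOp, Operand.write,
        Operand.read, merge_apply_of_lt, update_merge_of_lt, BinOp.eval_band, Nat.and_self, t24] at hm'
      subst hm'
      refine ⟨?_, ?_, fun a h13 h31' h32 h33 => ?_⟩
      · rw [merge_apply_of_lt (by omega), Function.update_of_ne (by omega), t13]
      · rw [merge_apply_of_lt (by omega), Function.update_self]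
        unfold V; rw [← max_assoc, max_eq_right hlt.le]
      · by_cases ha : a < 100
        · rw [merge_apply_of_lt ha, Function.update_of_ne h32, tf a h13 h31' h32 h33]
        · rw [merge_apply_of_le (by omega), tf a h13 h31' h32 h33]
  rintro m₄ ⟨u13, u32, uf⟩
  have u10 : m₄ 10 = g.Bv := (uf 10 (by omega) (by omega) (by omega) (by omega)).trans r10
  -- final block
  refine Achieves.seqs_cons (T₁ := 5) (T₂ := 0) ?_ fun _ h => Achieves.seqs_nil h
  refine achieves_block_of_eq (fun m' hm' => ?_) (by decide)
  simp (disch := first | omega | decide) only [execOps_cons, execOps_nil, execOp, Operand.write,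
    Operand.read, merge_apply_of_lt, update_merge_of_lt, Function.update_self,
    BinOp.eval_add_of_lt, BinOp.eval_band, Nat.and_self, u10, u32] at hm'
  subst hm'
  have hrest : ∀ a, a ≠ 11 → a ≠ 12 → a ≠ 13 → a ≠ 31 → a ≠ 32 → a ≠ 33 →
      merge (Function.update (Function.update (Function.update m₄ 11 (g.Bv + g.V)) 11 (g.Bv + g.V + 1)) 12 0)
        m₄ a = m a := by
    intro a h11 h12 h13 h31' h32 h33
    by_cases ha : a < 100
    · rw [merge_apply_of_lt ha]; simp (disch := omega) only [Function.update_of_ne]; exact uf a h13 h31' h32 h33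
    · rw [merge_apply_of_le (by omega)]; exact uf a h13 h31' h32 h33
  refine ⟨⟨?_, ?_, ?_, ?_, ?_, ?_, ?_, ?_, ?_, ?_, ?_, ?_, ?_, ?_, ?_, ?_, ?_, ?_, ?_, ?_⟩, ⟨?_, ?_, ?_⟩, fun a ha => ?_⟩
  any_goals (rw [hrest _ (by omega) (by omega) (by omega) (by omega) (by omega) (by omega)]; assumption)
  · rw [merge_apply_of_lt (by omega)]; simp (disch := omega) only [Function.update_self, Function.update_of_ne]; omega
  · rw [merge_apply_of_lt (by omega)]; simp (disch := omega) only [Function.update_self]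
  · rw [merge_apply_of_lt (by omega)]; simp (disch := omega) only [Function.update_of_ne]; exact u13
  · rw [hrest _ (by omega) (by omega) (by omega) (by omega) (by omega) (by omega)]; exact hD a ha

end Params

end Prog

end DTWRed

end Literature.Computability.FineGrained
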